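import Summits.RiemannHypothesis.RiemannHypothesis.Theorems.ScrewManifestDivisorPair
import HarnessLib

/-!
# RH-FREE: factor-rich near lags are dense (L3′ of sos-theory note 3, SCREW-P3-PLATEAU-NOTE-g20 §3)

For the J-bound bypass of the plateau slot S2 one needs near pairs of rows BOTH of whose nodes
`m = i + 2`, `m' = j + 2` are FACTOR-RICH (`FactorRich`, `Theorems/ScrewManifestDivisorPair`): then the
divisor-pair identity pins both diagonals to the all-ones weight (`diag_bounds_of_factorRich`).

* `factorRich_twelve_mul`, `factorRich_thirtyfive_mul` : `12k` (`k ≥ 1`) and `35l` (`l ≥ 2`) are factor-rich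
  (`12k = 2·6k = 3·4k`, `35l = 5·7l = 7·5l`);
* `lag_bracket` : the scaled lag of the rows `m = q + a`, `m' = q` is `N·log((q+a)/q) ∈ [aN/(q+a), aN/q]`;
* `factorRichLagDensity` : for every `δ > 0` and `N = n + 1 ≥ ⌈7560/δ⌉₊ + 1400`, every
  `x ∈ [1, 3]` is within `δ` of a scaled lag `N·(node i − node j)`, `j < i`, with `i + 2` and `j + 2`
  factor-rich.  Proof: progressions `m' = 455 + 420u = 35(13 + 12u)`, `m = m' + 1 = 12(38 + 35u)`
  (step `a = 1`, `x ≤ 2`) and `m' = 70 + 420u = 35(2 + 12u)`, `m = m' + 2 = 12(6 + 35u)` (step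
  `a = 2`, `x > 2`), with `m'` the largest progression element below `min(aN/x, N − a)`; the lag mesh
  is then `O(420/N)`.  (No top-half condition is needed by the J-assembly, so none is recorded.)

RH-FREE elementary arithmetic of logarithms of integers; nothing here bears on the truth of RH.
References: [folklore].
-/

set_option linter.dupNamespace false
set_option autoImplicit false

noncomputable section

open Real

namespace Summit.RiemannHypothesis.RiemannHypothesis.Theorems.IntegerScrew.Manifest

/-- `12k` is factor-rich for `k ≥ 1`: `12k = 2·(6k) = 3·(4k)`. [folklore] -/
theorem factorRich_twelve_mul (k : ℕ) (hk : 1 ≤ k) : FactorRich (12 * k) :=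
  ⟨2, 6 * k, 3, 4 * k, by omega⟩

/-- `35l` is factor-rich for `l ≥ 2`: `35l = 5·(7l) = 7·(5l)`. [folklore] -/
theorem factorRich_thirtyfive_mul (l : ℕ) (hl : 2 ≤ l) : FactorRich (35 * l) :=
  ⟨5, 7 * l, 7, 5 * l, by omega⟩

/-- The progression `455 + 420u`, `456 + 420u` consists of factor-rich pairs at distance `1`. [folklore] -/
theorem factorRich_prog_one (u : ℕ) : FactorRich (455 + 420 * u) ∧ FactorRich (455 + 420 * u + 1) := by
  constructor
  · rw [show 455 + 420 * u = 35 * (13 + 12 * u) by ring]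
    exact factorRich_thirtyfive_mul _ (by omega)
  · rw [show 455 + 420 * u + 1 = 12 * (38 + 35 * u) by ring]
    exact factorRich_twelve_mul _ (by omega)

/-- The progression `70 + 420u`, `72 + 420u` consists of factor-rich pairs at distance `2`. [folklore] -/
theorem factorRich_prog_two (u : ℕ) : FactorRich (70 + 420 * u) ∧ FactorRich (70 + 420 * u + 2) := by
  constructor
  · rw [show 70 + 420 * u = 35 * (2 + 12 * u) by ring]
    exact factorRich_thirtyfive_mul _ (by omega)
  · rw [show 70 + 420 * u + 2 = 12 * (6 + 35 * u) by ring]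
    exact factorRich_twelve_mul _ (by omega)

/-- A progression element just below a real level: for `r ≤ Y` there is `u` with
`r + 420u ≤ Y < r + 420u + 420`. [folklore] -/
theorem exists_prog_le (r : ℕ) {Y : ℝ} (hY : (r : ℝ) ≤ Y) :
    ∃ u : ℕ, (r : ℝ) + 420 * (u : ℝ) ≤ Y ∧ Y < (r : ℝ) + 420 * (u : ℝ) + 420 := by
  have hz : 0 ≤ (Y - r) / 420 := by apply div_nonneg <;> linarith
  refine ⟨⌊(Y - r) / 420⌋₊, ?_, ?_⟩
  · have h := Nat.floor_le hz
    have : (420 : ℝ) * (⌊(Y - r) / 420⌋₊ : ℝ) ≤ 420 * ((Y - r) / 420) :=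
      mul_le_mul_of_nonneg_left h (by norm_num)
    have e : (420 : ℝ) * ((Y - r) / 420) = Y - r := by field_simp
    linarith
  · have h := Nat.lt_floor_add_one ((Y - r) / 420)
    have : (420 : ℝ) * ((Y - r) / 420) < 420 * ((⌊(Y - r) / 420⌋₊ : ℝ) + 1) :=
      mul_lt_mul_of_pos_left h (by norm_num)
    have e : (420 : ℝ) * ((Y - r) / 420) = Y - r := by field_simp
    linarith

/-- **Lag bracket with explicit rows.** For `2 ≤ q`, `1 ≤ a`, `q + a ≤ n + 1`, the rows `i = q + a − 2`,
`j = q − 2` (nodes `q + a` and `q`) have scaled lag `(n+1)·log((q+a)/q) ∈ [a(n+1)/(q+a), a(n+1)/q]`.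
[folklore] -/
theorem lag_bracket (n q a : ℕ) (hq : 2 ≤ q) (ha : 1 ≤ a) (hqa : q + a ≤ n + 1) :
    ∃ i j : Fin n, (i : ℕ) = q + a - 2 ∧ (j : ℕ) = q - 2 ∧
      (a : ℝ) * ((n : ℝ) + 1) / ((q : ℝ) + a) ≤ ((n : ℝ) + 1) * (node n i - node n j) ∧
      ((n : ℝ) + 1) * (node n i - node n j) ≤ (a : ℝ) * ((n : ℝ) + 1) / (q : ℝ) := by
  have hi : q + a - 2 < n := by omega
  have hj : q - 2 < n := by omega
  refine ⟨⟨q + a - 2, hi⟩, ⟨q - 2, hj⟩, rfl, rfl, ?_⟩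
  have hN : (0 : ℝ) < (n : ℝ) + 1 := by positivity
  have hq0 : (0 : ℝ) < (q : ℝ) := by exact_mod_cast (show 0 < q by omega)
  have hqa0 : (0 : ℝ) < (q : ℝ) + a := by positivity
  have hlag : node n ⟨q + a - 2, hi⟩ - node n ⟨q - 2, hj⟩
      = Real.log (((q : ℝ) + a) / (q : ℝ)) := by
    simp only [node]
    rw [show q + a - 2 + 2 = q + a by omega, show q - 2 + 2 = q by omega]
    push_cast
    rw [← Real.log_div hqa0.ne' hq0.ne']
  rw [hlag]
  have hu : 0 < ((q : ℝ) + a) / (q : ℝ) := by positivity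
  have hup : Real.log (((q : ℝ) + a) / q) ≤ (a : ℝ) / q := by
    have := Real.log_le_sub_one_of_pos hu
    have e : ((q : ℝ) + a) / q - 1 = (a : ℝ) / q := by field_simp; ring
    linarith
  have hlo : (a : ℝ) / ((q : ℝ) + a) ≤ Real.log (((q : ℝ) + a) / q) := by
    have := Real.one_sub_inv_le_log_of_pos hu
    have e : 1 - (((q : ℝ) + a) / q)⁻¹ = (a : ℝ) / ((q : ℝ) + a) := by field_simp; ring
    linarith
  constructor
  · rw [show (a : ℝ) * ((n : ℝ) + 1) / ((q : ℝ) + a) = ((n : ℝ) + 1) * ((a : ℝ) / ((q : ℝ) + a)) by ring]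
    exact mul_le_mul_of_nonneg_left hlo hN.le
  · rw [show (a : ℝ) * ((n : ℝ) + 1) / (q : ℝ) = ((n : ℝ) + 1) * ((a : ℝ) / q) by ring]
    exact mul_le_mul_of_nonneg_left hup hN.le

/-- Core step of the density argument: step `a ∈ {1, 2}`, progression `r + 420u` (`2 ≤ r ≤ 455`) of
factor-rich pairs at distance `a`, level `x ∈ [a, 3]`, `N = n + 1 ≥ 7560/δ + 1400`. [folklore] -/
theorem factorRichLag_core (a r : ℕ) (ha1 : 1 ≤ a) (ha2 : a ≤ 2) (hr2 : 2 ≤ r) (hr : r ≤ 455)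
    (hrich : ∀ u : ℕ, FactorRich (r + 420 * u) ∧ FactorRich (r + 420 * u + a))
    {δ : ℝ} (hδ : 0 < δ) {n : ℕ} (hn : 7560 / δ + 1400 ≤ (n : ℝ) + 1)
    {x : ℝ} (hxa : (a : ℝ) ≤ x) (hx3 : x ≤ 3) :
    ∃ i j : Fin n, (j : ℕ) < (i : ℕ) ∧ FactorRich ((i : ℕ) + 2) ∧ FactorRich ((j : ℕ) + 2) ∧
      |x - ((n : ℝ) + 1) * (node n i - node n j)| ≤ δ := by
  set N : ℝ := (n : ℝ) + 1 with hNdef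
  have ha1' : (1 : ℝ) ≤ a := by exact_mod_cast ha1
  have ha2' : (a : ℝ) ≤ 2 := by exact_mod_cast ha2
  have hx0 : 0 < x := by linarith
  have hN1400 : 1400 ≤ N := by
    have : 0 ≤ 7560 / δ := by positivity
    linarith
  have hN0 : 0 < N := by linarith
  have hδN : 7560 + 1400 * δ ≤ δ * N := by
    have h1 : 7560 / δ ≤ N - 1400 := by linarith
    rw [div_le_iff₀ hδ] at h1
    nlinarith
  -- the level `Y` and the progression element `q` below it
  set Y : ℝ := min (a * N / x) (N - a) with hY
  have hY1 : Y ≤ a * N / x := min_le_left _ _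
  have hY2 : Y ≤ N - a := min_le_right _ _
  have hYlo : N / 3 - 2 ≤ Y := by
    refine le_min ?_ (by linarith)
    rw [le_div_iff₀ hx0]
    nlinarith
  have hrY : (r : ℝ) ≤ Y := by
    have : (r : ℝ) ≤ 455 := by exact_mod_cast hr
    linarith
  obtain ⟨u, hu1, hu2⟩ := exists_prog_le r hrY
  set q : ℕ := r + 420 * u with hqdef
  have hqR : (q : ℝ) = (r : ℝ) + 420 * (u : ℝ) := by rw [hqdef]; push_cast; ring
  have hqY : (q : ℝ) ≤ Y := by rw [hqR]; exact hu1
  have hYq : Y < (q : ℝ) + 420 := by rw [hqR]; exact hu2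
  have hq2 : 2 ≤ q := by omega
  have hq0 : (0 : ℝ) < q := by exact_mod_cast (show 0 < q by omega)
  have hqbig : N / 3 - 422 ≤ (q : ℝ) := by linarith
  have hqaN : (q : ℝ) + a ≤ N := by linarith
  have hqa : q + a ≤ n + 1 := by
    have : ((q + a : ℕ) : ℝ) ≤ (n : ℝ) + 1 := by push_cast; rw [← hNdef]; exact hqaN
    exact_mod_cast this
  obtain ⟨i, j, hi, hj, hlo, hhi⟩ := lag_bracket n q a hq2 ha1 hqa
  rw [← hNdef] at hlo hhi
  refine ⟨i, j, by omega, ?_, ?_, ?_⟩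
  · rw [hi, show q + a - 2 + 2 = r + 420 * u + a by omega]; exact (hrich u).2
  · rw [hj, show q - 2 + 2 = r + 420 * u by omega]; exact (hrich u).1
  · set ℓ := N * (node n i - node n j) with hℓ
    have hqx : (q : ℝ) * x ≤ a * N := by
      have := le_trans hqY hY1
      rwa [le_div_iff₀ hx0] at this
    have hδq : δ * (N / 3 - 422) ≤ δ * q := mul_le_mul_of_nonneg_left hqbig hδ.le
    rw [abs_le]
    constructor
    · -- `ℓ ≤ x + δ`, via `aN/q ≤ x + δ`
      have hup : (a : ℝ) * N / q ≤ x + δ := by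
        rw [div_le_iff₀ hq0]
        rcases min_choice (a * N / x) (N - a) with hc | hc
        · -- `Y = aN/x`: `aN < (q + 420)x`, and `420x ≤ δq`
          have h1 : a * N / x < (q : ℝ) + 420 := by rw [← hc]; exact hYq
          rw [div_lt_iff₀ hx0] at h1
          nlinarith
        · -- `Y = N − a`: `q > N − a − 420`, `x ≥ a`, and `844 ≤ δq`
          have h1 : N - a < (q : ℝ) + 420 := by rw [← hc]; exact hYq
          have h2 : (a : ℝ) * q ≤ x * q := mul_le_mul_of_nonneg_right hxa hq0.le
          nlinarith
      linarith
    · -- `x − δ ≤ ℓ`, via `x − δ ≤ aN/(q+a)`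
      have hlow : x - δ ≤ (a : ℝ) * N / ((q : ℝ) + a) := by
        rw [le_div_iff₀ (by positivity)]
        nlinarith
      linarith

/-- **L3′ (RH-free): factor-rich near lags are dense in `[1, 3]`.** For every `δ > 0` there is `M₀`
(`M₀ = ⌈7560/δ⌉₊ + 1400`) such that for `n + 1 ≥ M₀` every `x ∈ [1, 3]` is within `δ` of a scaled lag `(n+1)·(node i − node j)`,
`j < i`, with BOTH `i + 2` and `j + 2` factor-rich. [folklore] -/
theorem factorRichLagDensity (δ : ℝ) (hδ : 0 < δ) :
    ∃ M₀ : ℕ, ∀ n : ℕ, M₀ ≤ n + 1 → ∀ x : ℝ, 1 ≤ x → x ≤ 3 →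
      ∃ i j : Fin n, (j : ℕ) < (i : ℕ) ∧ FactorRich ((i : ℕ) + 2) ∧ FactorRich ((j : ℕ) + 2) ∧
        |x - ((n : ℝ) + 1) * (node n i - node n j)| ≤ δ := by
  refine ⟨⌈7560 / δ⌉₊ + 1400, fun n hn x hx1 hx3 => ?_⟩
  have hn' : 7560 / δ + 1400 ≤ (n : ℝ) + 1 := by
    have h1 : ((⌈7560 / δ⌉₊ + 1400 : ℕ) : ℝ) ≤ (n : ℝ) + 1 := by exact_mod_cast hn
    push_cast at h1
    have h2 := Nat.le_ceil (7560 / δ)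
    linarith
  by_cases hx2 : x ≤ 2
  · exact factorRichLag_core 1 455 le_rfl (by norm_num) (by norm_num) le_rfl factorRich_prog_one
      hδ hn' (by push_cast; linarith) hx3
  · push Not at hx2
    exact factorRichLag_core 2 70 (by norm_num) le_rfl (by norm_num) (by norm_num) factorRich_prog_two
      hδ hn' (by push_cast; linarith) hx3

end Summit.RiemannHypothesis.RiemannHypothesis.Theorems.IntegerScrew.Manifest

end
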